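import Summits.BirchSwinnertonDyer.BirchSwinnertonDyer.Theorems.ClassRecordThreeCornerAtThreeShimuraSwapFamilySupply
import Summits.BirchSwinnertonDyer.BirchSwinnertonDyer.Theorems.ClassRecordThreeEulerHalvesAtThreeLevelSupplyB6DOfPoitouTate
import Summits.BirchSwinnertonDyer.BirchSwinnertonDyer.Theorems.ClassRecordThreeEulerHalvesAtThreeKolyvaginFamilyTildeSign
import Summits.BirchSwinnertonDyer.BirchSwinnertonDyer.Theorems.ClassRecordThreeEulerHalvesAtThreeKolyvaginFamilyRootClass
import Summits.BirchSwinnertonDyer.BirchSwinnertonDyer.Theorems.ClassRecordThreeEulerHalvesAtThreeKolyvaginFamilyInvariance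
import Summits.BirchSwinnertonDyer.BirchSwinnertonDyer.Theorems.ClassRecordThreeEulerHalvesAtThreeKolyvaginFamilyStanding
import Summits.BirchSwinnertonDyer.BirchSwinnertonDyer.Theorems.ClassRecordThreeEulerHalvesAtThreeWalkSupplyTransverse
import Summits.BirchSwinnertonDyer.BirchSwinnertonDyer.Theorems.ClassRecordThreeCornerAtThreeShimuraFamilyTransverse
import Summits.BirchSwinnertonDyer.BirchSwinnertonDyer.Theorems.ClassRecordThreeCornerAtThreeShimuraFamilyProducers
import Summits.BirchSwinnertonDyer.BirchSwinnertonDyer.Theorems.ClassRecordThreeCornerAtThreeShimuraFamilyProducersLocal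
import Summits.BirchSwinnertonDyer.BirchSwinnertonDyer.Theorems.ClassRecordThreeCornerAtThreeShimuraFamilyH47Orders
import Summits.BirchSwinnertonDyer.BirchSwinnertonDyer.Theorems.ClassRecordThreeCornerAtThreeShimuraWalkB6DDefs
import Summits.BirchSwinnertonDyer.BirchSwinnertonDyer.Theorems.Rank1ResidualJetSelmerLemmas
import Summits.BirchSwinnertonDyer.BirchSwinnertonDyer.Theorems.Rank1ResidualJetRingClassFields
import Literature.NumberTheory.EllipticCurves.BSDSelmerCMPConverseHeegnerFieldProofs
import HarnessLib

/-!
# `SwapSupplyAt` AT ANY ODD PRIME `p ∈ S` FROM POITOU–TATE AND A GROSS-CURRENCY ČEBOTAREV SUPPLY — the `p`-generic form of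
# port target 1 (Kolyvagin's prime swap for a labelled CM family on a Shimura frame, `d_K < −4`)
# (cell `bsd-stepL`, seat `bsd-stepL-corner3-p2` g9 = WIDTH-LEVER lane B; `--supports stmt-BirchSwinnertonDyer-21420 --as helper`;
# serves crux 19109 at `p = 3` and crux 19065's `stub_savedDisplay57` road at `p ∈ {5, 7}`)

WHAT. `ShimuraWalk.swapSupplyAt_of_poitouTate_of_hceb`: for EVERY odd prime `p` with `E[p]` irreducible and `p ∈ S` (hence `p` inert and unramified
in `K`), every labelled family `ys` (`LabelsAt` ∧ `LabelB6` at the bad primes outside `S`) on a Shimura frame at an imaginary quadratic `K` with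
`d_K < −4`: `ShimuraWalk.SwapSupplyAt hK ι W N p ys` (McCallum Prop. 5.2 in Gross's depth currency) from Poitou–Tate duality for the tree's Selmer
structures (`hPT`, named fact) and a Čebotarev supply `hceb` in corner-p1's binder shape (McCallum Cor. 3.2 ∕ Jetchev Lemma 5.1 for a pair of opposite
`τ`-eigenclasses in `H¹(K, E[p])`, primes with `IsKolyvaginPrime ∧ FrobEqFrobInfty (p^{1+j})` beyond any bound). The proof is p608802's
(`swapSupplyAtThreeB6D_of_poitouTate`, `p = 3`) with `3 ↦ p` and `hceb` displayed instead of discharged: corner-p1 g15's (P1) layer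
`Swap.shimuraWalk_swapSupplyAt_of_family` (p607230) with {hbot, hB4, hA, hP, hsign, hsel, h44} discharged by lane B g8's ∀-datum producers (p605208 ∕
p605614 ∕ p603631 ∕ p605268), tam3-p1's standing inputs and bridges (p603099 ∕ p604825 ∕ `Koly.familyRootKummer_of_selmerLocalKer` ∕
`JET.Walk.globalTransverse_mem_iff`) and bsd-jet's `mem_selmerGroup_selmerF_iff`. At `p = 3` with `hceb := Koly.hceb_family_three_of_mem_inertSet`
it specialises to the landed port target `swapSupplyAtThreeB6D_of_poitouTate` (checked; not restated — `dedup.landed`). The Shimura-curve data `X ∕ W' ∕ P₀`, `Even S.card`, `3 ∤ c(Dt)` and minimality of the B6D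
frame are NOT used by the swap and are not binders here.

WHY. corner-p1 g15 (CORNER-G15 §3): the (P1) files are `p`-GENERIC; crux 19065's `stub_savedDisplay57` (= `ShimuraInertSavedDisplayAt W p q₁`,
`p ∈ {5, 7}`) is derived through (DIV) at `p`, i.e. through `SwapSupplyAt` + `LevelSupplyAt` at `p`; on that corner `hceb` is corner-p1's
`Koly.hceb_family_of_irr_of_neg` (`−1 ∈ ρ̄` automatic at `5`, genuine at `7`). This file hands the swap half over at every odd `p` in one call.

HONEST FRAMING: conditional theorems (inputs `hPT`, `hceb`, the labels); no definition, no named fact, no `sorry`; nothing booked; no item closes;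
no census label moves (T7); BSD is not proved by any of this. References (locators only): [cite: McCallumLMS1991, §5 Prop. 5.2 and proof (pp. 304–306),
§4 Prop. 4.4, §3 Cor. 3.2] [cite: GrossLMS1991, §3 (3.2), Prop. 3.6, Prop. 5.4, §6 Prop. 6.2 (1)] [cite: Jetchev2008, §3.1.2, §3.4.1, Lemma 5.1]
[cite: Howard2004HeegnerKolyvagin, Lemma 2.7.3] [cite: MilneADT2006, Ch. I, Thm. 4.10(b)]. presearch: not applicable (assembly of tree theorems).
Axioms: `propext`, `Classical.choice`, `Quot.sound`.
-/

set_option autoImplicit false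
set_option linter.dupNamespace false

noncomputable section

open scoped Classical NumberField Pointwise

namespace Summit.BirchSwinnertonDyer.BirchSwinnertonDyer.Theorems.ShimuraWalk

open WeierstrassCurve IsDedekindDomain NumberField Field Function Literature.NumberTheory.EllipticCurves
  Literature.NumberTheory.EllipticCurves.ModularForms Literature.NumberTheory.EllipticCurves.Jetchev2008
  Literature.NumberTheory.EllipticCurves.KolyvaginCocycle
  Literature.NumberTheory.EllipticCurves.Rank1Residual Literature.NumberTheory.GaloisRepresentations
  Literature.NumberTheory.GaloisCohomology Literature.NumberTheory.Automorphic
  Summit.BirchSwinnertonDyer.Rank1Residual.JET Summit.BirchSwinnertonDyer.Rank1Residual.JET.SelmerVocabulary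
  Summit.BirchSwinnertonDyer.Rank1Residual.JET.Walk Summit.BirchSwinnertonDyer.Rank1Residual.JET.GlobalDuality
  Summit.BirchSwinnertonDyer.Rank1Residual.X11b Summit.BirchSwinnertonDyer.Rank1Residual.X11b.Three
  Summit.BirchSwinnertonDyer.BirchSwinnertonDyer.Theorems
  Literature.NumberTheory.EllipticCurves.ShimuraCMFamily

set_option maxHeartbeats 800000 in
/-- **`SwapSupplyAt` at ANY odd prime `p ∈ S` from Poitou–Tate + a Gross-currency Čebotarev supply** — the `p`-GENERIC form of
`swapSupplyAtThreeB6D_of_poitouTate` (p608802): Kolyvagin's prime swap (McCallum Prop. 5.2, Gross depth (3.2)) for a labelled family `ys`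
(`LabelsAt` ∧ `LabelB6`) on a Shimura frame at an imaginary quadratic `K` with `d_K < −4`, `S` inert and prime to `d_K` (so `p ∈ S` is
unramified in `K`), the bad primes outside `S` split, `E[p]` irreducible — corner-p1 g15's (P1) layer `Swap.shimuraWalk_swapSupplyAt_of_family`
(p607230) with its dictionary {hbot, hB4, hA, hP, hsign, hsel, h44} DISCHARGED exactly as in p608802 (lane B g8 producers p605208 ∕ p605614 ∕
p603631 ∕ p605268, tam3-p1 p603099 ∕ p604825 ∕ `familyRootKummer_of_selmerLocalKer` ∕ `globalTransverse_mem_iff`, bsd-jet `mem_selmerGroup_selmerF_iff`),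
the Čebotarev supply `hceb` LEFT DISPLAYED in corner-p1's binder shape (at `p = 3` on the carrier-inert frames it is
`Koly.hceb_family_three_of_mem_inertSet`; for `ρ̄` onto ∕ `E[p]` irreducible with `−1 ∈ ρ̄(Γ_ℚ)` — crux 19065's `p ∈ {5, 7}` — it is corner-p1's
`Koly.hceb_family_of_surj` ∕ `Koly.hceb_family_of_irr_of_neg`). Serves 21420 ∕ 19109 at `p = 3` and 19065's `stub_savedDisplay57` road at `p ∈ {5,7}`.
CONDITIONAL on `hPT` and `hceb`; nothing booked. [cite: McCallumLMS1991, §5 Prop. 5.2, §4 Prop. 4.4, §3 Cor. 3.2]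
[cite: GrossLMS1991, §3 (3.2), Prop. 5.4, §6 Prop. 6.2 (1)] [cite: Jetchev2008, §3.1.2, §3.4.1, Lemma 5.1] [cite: Howard2004HeegnerKolyvagin, Lemma 2.7.3] -/
theorem swapSupplyAt_of_poitouTate_of_hceb
    (hPT : ∀ (K : Type) [Field K] [NumberField K], poitouTate_selmerStructure_duality_conj K)
    (W : WeierstrassCurve ℚ) [W.IsElliptic] [W.IsGloballyMinimal] (N : ℕ) [NeZero N]
    (K : Type) [Field K] [NumberField K] (S : Finset ℕ) (Dt : ModularParametrizationData W N)
    (hN : W.conductorNorm ℤ = N) {p : ℕ} [Fact p.Prime] (hp2 : p ≠ 2) (hirr : W.HasIrreducibleModPGaloisRep p)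
    (hK : IsImaginaryQuadratic K) (hD : NumberField.discr K < -4)
    (hin : ∀ ℓ ∈ S, ℓ.Prime ∧ ℓ ∣ N ∧ ¬ ℓ ^ 2 ∣ N ∧
      ((Ideal.span {(ℓ : ℤ)}).primesOver (𝓞 K)).ncard = 1 ∧ ¬ (ℓ : ℤ) ∣ NumberField.discr K)
    (hsp : ∀ ℓ : ℕ, ℓ.Prime → ℓ ∣ N → ℓ ∉ S → ((Ideal.span {(ℓ : ℤ)}).primesOver (𝓞 K)).ncard = 2)
    (hpS : p ∈ S) (ι : K →+* ℂ) (y : (W.baseChange K).toAffine.Point)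
    (ys : (m : ℕ) → (W.baseChange (ringClassField K ι m)).toAffine.Point) (ε : ℤ)
    (hL : LabelsAt W N K ι y ys ε) (hB6 : LabelB6 ι W N (N.primeFactors.filter (· ∉ S)) ys)
    (hceb : ∀ (τ : K ≃ₐ[ℚ] K), τ ≠ 1 → ∀ (j : ℕ) (e₁ : ℤ), (e₁ = 1 ∨ e₁ = -1) →
      ∀ (x y : galoisCohomology ((W.baseChange K).torsionGaloisModule ((p ^ 1 : ℕ) : ℤ)) 1),
      conjAct W τ ((p ^ 1 : ℕ) : ℤ) x = e₁ • x → conjAct W τ ((p ^ 1 : ℕ) : ℤ) y = (-e₁) • y → y ≠ 0 →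
      ∀ (b : ℕ), ∃ ℓ : ℕ, b < ℓ ∧ IsKolyvaginPrime N W K p ℓ ∧ FrobEqFrobInfty W K (p ^ (1 + j)) ℓ ∧
        ∀ v : HeightOneSpectrum (𝓞 K), (ℓ : 𝓞 K) ∈ v.asIdeal →
          addOrderOf (galoisCohomology.localization
              ((W.baseChange K).torsionGaloisModule ((p ^ 1 : ℕ) : ℤ)) (Sum.inr v) 1 x) = addOrderOf x ∧
          addOrderOf (galoisCohomology.localization
              ((W.baseChange K).torsionGaloisModule ((p ^ 1 : ℕ) : ℤ)) (Sum.inr v) 1 y) = addOrderOf y) :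
    SwapSupplyAt hK ι W N p ys := by
  subst hN
  haveI : ∀ j : ℕ, NumberField (ringClassField K ι j) := numberField_ringClassField K hK ι
  have hp : p.Prime := Fact.out
  have hD3 : NumberField.discr K ≠ -3 := by omega
  have hD4 : NumberField.discr K ≠ -4 := by omega
  -- `E(K)[p] = 0` (`E[p]` irreducible)
  have hbot : AddSubgroup.torsionBy (W.baseChange K).toAffine.Point ((p : ℕ) : ℤ) = ⊥ :=
    torsionBy_eq_bot_of_isImaginaryQuadratic_of_hasIrreducibleModPGaloisRep W K hK hp hirr
  -- `p` is unramified in `K` (`p ∈ S`), the Weil pairing; admissibility of `E(K[n])` for every datum (`E[p]` irreducible)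
  have hKunr := ShimuraKolyvaginOfImage.isUnramifiedIn_rat_of_not_dvd_discr K hp (hin p hpS).2.2.2.2
  have hWp := WeierstrassCurve.exists_weilPairing_holds W p
  have hA : ∀ (n : ℕ) (d : KolyvaginFamilyData W K ι n), d.y = ys n → Squarefree n →
      (∀ q' ∈ n.primeFactors, IsKolyvaginPrime (W.conductorNorm ℤ) W K p q') →
      ∀ j : ℕ, IsAdmissible (absoluteGaloisGroup K) d.pointsSubgroup ((p ^ j : ℕ) : ℤ) :=
    fun n d _ hn hKP j ↦ d.isAdmissible_pointsSubgroup_family_of_hasIrreducibleModPGaloisRep hK hn.ne_zero hp hp2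
      hirr hWp hKunr (fun hpn ↦ (hKP p (Nat.mem_primeFactors.mpr ⟨hp, hpn, hn.ne_zero⟩)).2.2.2.1 rfl) j
  -- invariance of `[P_n]` mod `p^j`, `1 ≤ j ≤ M(n)`, for every datum (tam3-p1's p604825, from (B4) of `LabelsAt`)
  have hP := Koly.familyInvariance_of_labelsAt W hK ι hp Dt ys hL
  -- Gross 6.2 (1) for every datum at the finite places off `n` (lane B g8's `hSel`, from (B4)+(B6))
  have hSel : ∀ (M n : ℕ) (d : KolyvaginFamilyData W K ι n), 1 ≤ M → d.y = ys n → Squarefree n →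
      (∀ q ∈ n.primeFactors, IsKolyvaginPrime (W.conductorNorm ℤ) W K p q ∧ FrobEqFrobInfty W K (p ^ M) q) →
      ∀ 𝔳 : HeightOneSpectrum (𝓞 K), (n : 𝓞 K) ∉ 𝔳.asIdeal →
        d.kolyvaginClass (Fact.out : p.Prime) M ∈
          selmerLocalKer (W.baseChange K) (𝔳.adicCompletion K) ((p ^ M : ℕ) : ℤ) :=
    fun M n d hM hdy hn hKol 𝔳 h𝔳 ↦
      kolyvaginClass_familyData_mem_selmerLocalKer_of_labelsAt hK ι rfl Dt hirr hin hsp ys hL hB6 hA M n d hM hdy hn hKol 𝔳 h𝔳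
  -- the Gross level index from `Frob = Frob_∞` on `K(E[p^j])` at every prime of `n`
  have hidx : ∀ {n : ℕ} (j : ℕ), (∀ q ∈ n.primeFactors, IsKolyvaginPrime (W.conductorNorm ℤ) W K p q ∧
      FrobEqFrobInfty W K (p ^ j) q) → ((j : ℕ) : ℕ∞) ≤ frobLevelIndex W K p n :=
    fun j hKol ↦ (natCast_le_frobLevelIndex_iff (fun q hq ↦ (hKol q hq).1) j).mpr fun q hq ↦ (hKol q hq).2
  -- the (P1) swap layer with the dictionary discharged
  refine Swap.shimuraWalk_swapSupplyAt_of_family W hPT hK hD3 hD4 p hp2 ι Dt ys hbot ?_ hceb ?_ ?_ hL.1 ?_ ?_ ?_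
  · -- `hB4` read off (B4) of `LabelsAt`
    intro k hk hKP ℓ hℓ σ hσ
    have hle : ringClassField K ι (k / ℓ) ≤ ringClassField K ι k :=
      ringClassField_mono hK ι (Nat.div_dvd_of_dvd (Nat.dvd_of_mem_primeFactors hℓ)) hk.ne_zero
    exact ⟨_, hL.2.2.2.2.1 k hk (fun q' hq' ↦ ⟨(hKP q' hq').2.1, (hKP q' hq').2.2.2.2.1⟩) ℓ hℓ hle σ hσ⟩
  · -- `hA`
    intro u m dm hdy hm hKol
    exact hA m dm hdy hm (fun q hq ↦ (hKol q hq).1) (1 + u)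
  · -- `hP`
    intro u m dm hdy hm hKol
    have hKol' : ∀ q ∈ m.primeFactors, IsKolyvaginPrime (W.conductorNorm ℤ) W K p q ∧ FrobEqFrobInfty W K (p ^ (1 + u)) q :=
      fun q hq ↦ ⟨(hKol q hq).1, by rw [Nat.add_comm]; exact (hKol q hq).2⟩
    exact hP m dm hdy hm (fun q hq ↦ (hKol q hq).1) (1 + u) (Nat.le_add_right 1 u) (hidx (1 + u) hKol')
  · -- `hsign`: Gross 5.4 in CLASS form at level `p^{1+u}` (point-level sign p605208 ⟹ class, root `Q := P_m`, `u := 0`)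
    intro τ hτ u m dm hdy hm hKol
    have hKP : ∀ q ∈ m.primeFactors, IsKolyvaginPrime (W.conductorNorm ℤ) W K p q := fun q hq ↦ (hKol q hq).1
    have hKol' : ∀ q ∈ m.primeFactors, IsKolyvaginPrime (W.conductorNorm ℤ) W K p q ∧ FrobEqFrobInfty W K (p ^ (1 + u)) q :=
      fun q hq ↦ ⟨hKP q hq, by rw [Nat.add_comm]; exact (hKol q hq).2⟩
    have hA' : IsAdmissible (absoluteGaloisGroup K) dm.pointsSubgroup ((p ^ (1 + u) : ℕ) : ℤ) := hA m dm hdy hm hKP (1 + u)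
    have hP' : dm.toGeomPoints dm.derivedPoint ∈ invPoints (absoluteGaloisGroup K) dm.pointsSubgroup ((p ^ (1 + u) : ℕ) : ℤ) :=
      hP m dm hdy hm hKP (1 + u) (Nat.le_add_right 1 u) (hidx (1 + u) hKol')
    have hcong := pointsMap_derivedPoint_familyData_of_labelsAt hK ι Dt hp ys hL hA hτ (isLiftOfAut_liftAut τ) m dm hdy hm
      hKP (1 + u) (Nat.le_add_right 1 u) (hidx (1 + u) hKol')
    rw [dm.kolyvaginClass_eq_cocycleClass (Fact.out : p.Prime) (1 + u) hA' hP']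
    exact Koly.conjAct_kolyvaginClass_root_eq_smul_family dm hp (k := 1 + u) (u := 0) hA' (isLiftOfAut_liftAut τ)
      (dm.pointsMap_mem_pointsSubgroup_family hK hm.ne_zero (isLiftOfAut_liftAut τ)) _ hcong dm.derivedPoint
      (by rw [pow_zero, Nat.cast_one, one_smul]) hA' hP'
  · -- `hsel`: the level-`p` root classes lie in `H_{𝓕(m)}` for the global intrinsic transverse family (the vocabulary bridge)
    intro 𝒯 h𝒯 u m dm hdy hm hKol Q hA1 hQ hQP
    have hKP : ∀ q ∈ m.primeFactors, IsKolyvaginPrime (W.conductorNorm ℤ) W K p q := fun q hq ↦ (hKol q hq).1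
    have huk : ((u + 1 : ℕ) : ℕ∞) ≤ frobLevelIndex W K p m := hidx (u + 1) hKol
    refine (mem_selmerGroup_selmerF_iff W _ 𝒯 hm.ne_zero _).mpr ⟨?_, ?_⟩
    · exact Koly.familyRootKummer_of_selmerLocalKer W hK ι p ys hA hP hSel 1 m dm le_rfl hdy hm
        (fun q hq ↦ ⟨hKP q hq, (hKol q hq).2.of_dvd (pow_dvd_pow p (Nat.le_add_left 1 u))⟩) u Q hA1 hQ hQP huk
    · exact (globalTransverse_mem_iff h𝒯 hm _).mpr fun ℓ hℓ ↦
        rootClass_familyData_mem_transverseKer W hK hD hp2 ι 1 hm hKP dm u Q hA1 hQ hQP huk hℓ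
  · -- `h44`: McCallum Prop. 4.4 for ANY two presentations at `m ∣ mℓ`, order form, level `p^{1+u}` (lane B g8 p605268)
    intro u m l hml hl hlm hKol dm dml hdy hdly v hv
    have hm : Squarefree m := hml.squarefree_of_dvd (dvd_mul_right m l)
    have hKol' : ∀ q ∈ (m * l).primeFactors, IsKolyvaginPrime (W.conductorNorm ℤ) W K p q ∧
        FrobEqFrobInfty W K (p ^ (1 + u)) q :=
      fun q hq ↦ ⟨(hKol q hq).1, by rw [Nat.add_comm]; exact (hKol q hq).2⟩
    exact addOrderOf_localization_kolyvaginClass_familyData_eq_of_labels_of_admissible hK hD ι rfl hp2 Dt ys hL hA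
      (1 + u) m (m * l) dm dml l (Nat.le_add_right 1 u) hdy hdly hm hKol' hl hlm rfl v hv

end Summit.BirchSwinnertonDyer.BirchSwinnertonDyer.Theorems.ShimuraWalk

end
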